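import Literature.AlgebraicGeometry.Frobenioids.ArchimedeanPointBase
import HarnessLib

/-!
# Frobenioids II, Example 3.3 over the one-morphism base: `O^▷(−)` of the pseudo-terminal objects is
# ONE monoid — transport along LINEAR arrows is the identity on scalars

Mochizuki, *Inter-universal Teichmüller theory I*, Example 3.4 (i), kurims text (May 2020) p. 80:
"the linear morphisms among the pseudo-terminal objects of `C` determine unique isomorphisms [cf.
[FrdI], Definition 1.3, (iii), (c)] among the respective topological monoids "`O^▷(−)`" … In particular,
it makes sense to write "`O^▷(C_v)`"" [cite: Mochizuki2012, Ex 3.4 (i) p.80]; the underlying category is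
the classical "`C`" of Mochizuki, *The geometry of Frobenioids II*, Kyushu J. Math. **62** (2008), Ex. 3.3
[cite: MochizukiFrdII2008, Ex 3.3 (ii) p.28] over the one-morphism base (`ArchFrd.Cpt`,
`ArchimedeanPointBase.lean`, seat abc-iut-L1-t6).

PROOF-ONLY file. For the isotropic (pseudo-terminal, `Cpt.std_isPseudoTerminal`) objects `std t`,
`std t'` and a LINEAR arrow `φ : std t → std t'` of `C_v`: elements `α ∈ O^▷(std t)`, `β ∈ O^▷(std t')`
that are `φ`-compatible (`α ≫ φ = φ ≫ β`) have the SAME scalar in `O^▷_ℂ`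
(`Cpt.scalar_eq_of_comm` — the uniqueness in [FrdI] Def. 1.3 (iii)(c), explicit), and the compatible `β`
exists (`Cpt.exists_comm`, it is `(endEquivUnitDisc t').symm (endEquivUnitDisc t α)`). Hence, under the
identifications `Cpt.endEquivUnitDisc t : O^▷(std t) ≃* O^▷_ℂ` of `ArchimedeanPointBase.lean`, the
transport isomorphisms are identities: "`O^▷(C_v)`" is well defined. (Along an arrow of Frobenius degree
`d` the compatible element has scalar `c_α ^ d` — `Cpt.scalar_pow_eq_of_comm` — which is why print says
"linear".) Nothing disputed is involved; no side is taken on [IUTchIII] Cor. 3.12.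
-/

namespace Literature.AlgebraicGeometry.Frobenioids

open CategoryTheory

noncomputable section

namespace ArchFrd

namespace Cpt

variable {t t' : PosReal}

/-- The `C₀`-component of ANY arrow `std t → std t'` lies over the identity of `Spec ℂ` (both structure
isomorphisms are identities). [cite: MochizukiFrdII2008, Ex 3.3 (i) p.27] -/
theorem base_fst_eq_id' (φ : std t ⟶ std t') : C0.Base φ.fst = 𝟙 D0.complex := by
  have w := φ.w
  change C0.Base φ.fst ≫ 𝟙 D0.complex = 𝟙 D0.complex ≫ 𝟙 D0.complex at w
  rw [Category.id_comp] at w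
  erw [Category.comp_id] at w
  exact w

/-- Along an arrow `φ : std t → std t'` of Frobenius degree `d`, `φ`-compatible elements
`α ∈ O^▷(std t)`, `β ∈ O^▷(std t')` (`α ≫ φ = φ ≫ β`) satisfy `c_β = c_α ^ d` on scalars.
[cite: Mochizuki2012, Ex 3.4 (i) p.80] -/
theorem scalar_pow_eq_of_comm (φ : std t ⟶ std t')
    (α : PreFrobenioid.endSubmonoid (C.toElem ptBase) (std t))
    (β : PreFrobenioid.endSubmonoid (C.toElem ptBase) (std t'))
    (h : (α.1 : std t ⟶ std t) ≫ φ = φ ≫ (β.1 : std t' ⟶ std t')) :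
    C0.scalar (β.1 : std t' ⟶ std t').fst =
      C0.scalar (α.1 : std t ⟶ std t).fst ^ (C0.degFr φ.fst : ℕ) := by
  have hs := congrArg (fun ψ : std t ⟶ std t' => C0.scalar ψ.fst) h
  change C0.scalar ((α.1 : std t ⟶ std t).fst ≫ φ.fst) =
    C0.scalar (φ.fst ≫ (β.1 : std t' ⟶ std t').fst) at hs
  rw [C0.scalar_comp', C0.scalar_comp', base_fst_eq_id (α.1 : std t ⟶ std t), base_fst_eq_id' φ,
    degFr_fst_eq_one β.2, PNat.one_coe, pow_one] at hs
  dsimp only [D0.Hom.act] at hs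
  erw [D0.twists_id, D0.galAct_false, D0.galAct_false] at hs
  -- `hs : c_φ * c_α ^ d = c_β * c_φ`
  rw [mul_comm] at hs
  exact (mul_right_cancel hs).symm

/-- **Uniqueness of transport along LINEAR arrows ([FrdI] Def. 1.3 (iii)(c), explicit for `C_v`)**: for
a linear `φ : std t → std t'`, `φ`-compatible `α ∈ O^▷(std t)`, `β ∈ O^▷(std t')` have the same scalar,
i.e. the same image in `O^▷_ℂ` — "the linear morphisms among the pseudo-terminal objects of `C`
determine unique isomorphisms among the respective `O^▷(−)`", and under `endEquivUnitDisc` these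
isomorphisms are identities. [cite: Mochizuki2012, Ex 3.4 (i) p.80] -/
theorem scalar_eq_of_comm (φ : std t ⟶ std t') (hφ : PreFrobenioid.IsLinear (C.toElem ptBase) φ)
    (α : PreFrobenioid.endSubmonoid (C.toElem ptBase) (std t))
    (β : PreFrobenioid.endSubmonoid (C.toElem ptBase) (std t'))
    (h : (α.1 : std t ⟶ std t) ≫ φ = φ ≫ (β.1 : std t' ⟶ std t')) :
    ((endEquivUnitDisc t' β : unitDisc) : ℂ) = ((endEquivUnitDisc t α : unitDisc) : ℂ) := by
  rw [coe_endEquivUnitDisc, coe_endEquivUnitDisc, scalar_pow_eq_of_comm φ α β h,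
    show C0.degFr φ.fst = 1 from hφ, PNat.one_coe, pow_one]

/-- **Existence of transport**: for a linear `φ : std t → std t'` and `α ∈ O^▷(std t)`, the element of
`O^▷(std t')` with the same scalar is `φ`-compatible with `α`. [cite: Mochizuki2012, Ex 3.4 (i) p.80] -/
theorem comm_symm_endEquivUnitDisc (φ : std t ⟶ std t') (hφ : PreFrobenioid.IsLinear (C.toElem ptBase) φ)
    (α : PreFrobenioid.endSubmonoid (C.toElem ptBase) (std t)) :
    (α.1 : std t ⟶ std t) ≫ φ =
      φ ≫ (((endEquivUnitDisc t').symm (endEquivUnitDisc t α)).1 : std t' ⟶ std t') := by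
  have hφ1 : C0.degFr φ.fst = 1 := hφ
  refine CFP.Hom.ext (C0.hom_ext ?_ ?_ ?_) (Subsingleton.elim _ _)
  · change C0.Base (α.1 : std t ⟶ std t).fst ≫ C0.Base φ.fst =
      C0.Base φ.fst ≫ C0.Base (((endEquivUnitDisc t').symm (endEquivUnitDisc t α)).1 : std t' ⟶ std t').fst
    rw [base_fst_eq_id, base_fst_eq_id, base_fst_eq_id' φ]
    rfl
  · change C0.degFr (α.1 : std t ⟶ std t).fst * C0.degFr φ.fst =
      C0.degFr φ.fst * C0.degFr (((endEquivUnitDisc t').symm (endEquivUnitDisc t α)).1 : std t' ⟶ std t').fst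
    rw [degFr_fst_eq_one α.2, degFr_fst_eq_one ((endEquivUnitDisc t').symm (endEquivUnitDisc t α)).2,
      one_mul, mul_one]
  · change C0.scalar ((α.1 : std t ⟶ std t).fst ≫ φ.fst) =
      C0.scalar (φ.fst ≫ (((endEquivUnitDisc t').symm (endEquivUnitDisc t α)).1 : std t' ⟶ std t').fst)
    rw [C0.scalar_comp', C0.scalar_comp', base_fst_eq_id (α.1 : std t ⟶ std t), base_fst_eq_id' φ, hφ1,
      degFr_fst_eq_one ((endEquivUnitDisc t').symm (endEquivUnitDisc t α)).2, PNat.one_coe, pow_one,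
      pow_one]
    dsimp only [D0.Hom.act]
    erw [D0.twists_id, D0.galAct_false, D0.galAct_false]
    have hsc : C0.scalar (((endEquivUnitDisc t').symm (endEquivUnitDisc t α)).1 : std t' ⟶ std t').fst =
        C0.scalar (α.1 : std t ⟶ std t).fst := by
      apply Units.ext
      change (((endEquivUnitDisc t') ((endEquivUnitDisc t').symm (endEquivUnitDisc t α)) : unitDisc) : ℂ) =
        (C0.scalar (α.1 : std t ⟶ std t).fst : ℂ)
      rw [MulEquiv.apply_symm_apply, coe_endEquivUnitDisc]
    rw [hsc, mul_comm]

/-- **Existence**, packaged: for a linear `φ : std t → std t'` every `α ∈ O^▷(std t)` has a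
`φ`-compatible `β ∈ O^▷(std t')` (unique by `scalar_eq_of_comm`). [cite: Mochizuki2012, Ex 3.4 (i) p.80] -/
theorem exists_comm (φ : std t ⟶ std t') (hφ : PreFrobenioid.IsLinear (C.toElem ptBase) φ)
    (α : PreFrobenioid.endSubmonoid (C.toElem ptBase) (std t)) :
    ∃ β : PreFrobenioid.endSubmonoid (C.toElem ptBase) (std t'),
      (α.1 : std t ⟶ std t) ≫ φ = φ ≫ (β.1 : std t' ⟶ std t') :=
  ⟨_, comm_symm_endEquivUnitDisc φ hφ α⟩

/-- Linear arrows between the pseudo-terminal objects exist exactly when `t ≤ t'`; in particular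
`toStd t' (std t)` is linear, so the transports above are available between any two isotropic objects
in the direction of increasing tip. [cite: MochizukiFrdII2008, Ex 3.3 (i) p.27] -/
theorem isLinear_toStd (t t' : PosReal) : PreFrobenioid.IsLinear (C.toElem ptBase) (toStd t' (std t)) :=
  rfl

end Cpt

end ArchFrd

end

end Literature.AlgebraicGeometry.Frobenioids
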